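/-
Copyright (c) 2026 the pub-hodgecm-mathlib formalisation cell (harness21).  Prover seat hodgecm-mathlib-F0P3a-p02 (g22): LH4-plan (g6) WORD #53 (M5-α) «MÖBIUS LEVEL SHIFT»
(FINDING OF RECORD #3 = census `F0/P3a/F0P3a-p02/g22/CENSUS-M5-inert-consumers.v1_1.md` §3 R1 + §7: the WILD replacement of the Cayley literal); 2026-09-02.
-/
import Literature.NumberTheory.Automorphic.SplitTorusOrderCayleyShift   -- ★ the TAME Cayley shift (`2⁻¹ ∈ O`); brings ★ `SplitTorusOrderCyclicLattices` (`one∕mul∕inv_mem_span_pow`), `span_pow_le_span_pow_of_mem`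
import HarnessLib

/-!
# The MÖBIUS level shift: a unit-determinant integral Möbius transform of a split-torus parameter generates the SAME order, keeps the root distances, and — in the
# shape `p(t) ∕ (t·σp(t⁻¹))` — is NORM ONE identically; with the trace-one element of an unramified quadratic extension this replaces the Cayley shift at `|2| < 1`
# (Serre, *Local Fields* III §6, V §3; Weil 1964 §29; Kottwitz 1986 §3)

Topic `NumberTheory/Automorphic`; namespace `Literature.NumberTheory.Automorphic`.  THEOREMS ONLY (no definition, no instance, no notation, no named fact, no `sorry`).
Cell `pub/hodgecm-mathlib` (D-0151), crux H413 = `stmt-HodgeConjecture-24833`; half A line LH4 (dyadic pay-down leaf `Cruxes/H413/Lines/F0_P3c_DyadicPaydown.lean`, organ (D-UNR)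
PRINT by ruling D74′), mechanism M5 «Cayley ∕ Möbius level shift» of census F0P3a-p06 (g17) `DUNR-H2-CENSUS` §3; LH4-plan (g6) WORD #53 (M5-α) after the (P2b) census FINDING #3.
HONEST READER LABEL: BANKED base layer (its consumer (M5-β) «Möbius literal» = the `h2`-free twin of ★ `DepthZeroKappaTransferCayleyLiteral` is undealt); HC_CM is proved only
modulo the 7 printed citations (2 remaining: hLiu418 = stmt-HodgeConjecture-24832, h413 = stmt-HodgeConjecture-24833) until rung 0 closes; elementary algebra, count-neutral.

THE MATHEMATICS.  ★ `SplitTorusOrderCayleyShift` moves a norm-one torus element `t` near `1` (eigen-coordinates `γ_i`, `X_i = c⁻¹(γ_i − 1)`) to the norm-one Cayley literal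
`Y = (1 + Z)(1 − Z)⁻¹`, `Z = X(γ+1)⁻¹`, which generates the same order `R_X = span_O{X^j}` and has root distances `|γ_i − γ_j| ∕ |c|` — using `2⁻¹ ∈ O` TWICE (in `R_X = R_Z` and in
`R_Z = R_Y`): as a Möbius transform of `X` the Cayley literal is `((1+c)X + 2)∕((c−1)X + 2)`, of determinant `4`.  THIS FILE does the same for ANY integral Möbius transform
`Y = (pX + q)(rX + s)⁻¹` of UNIT determinant whose denominators `rX_i + s` are units (§1–§2: `R_X = R_Y`, `Y⁻¹ ∈ R_Y`, `Y_i − Y_j = det·(X_i − X_j)∕(den_i den_j)`), shows that the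
shape `Y = (βt + α)∕(σα·t + σβ)` (`= p(t)∕(t·σp(t⁻¹))`, `p = βT + α`) is NORM ONE for every norm-one `t` and every involution `σ` (§3), rewrites it as a Möbius transform of
`X = ϖ⁻¹(t − 1)` when `α + β = ϖγ` (§3), and (§4, valued) shows that with a TRACE-ONE element `a` (`a + σa = 1` — it exists in every UNRAMIFIED quadratic extension of local fields,
★ `UnramifiedLocalConjDatum.trace`, dyadic residue characteristic included) the choice `β = 1, γ = a` has unit determinant `1 − ϖ·aσa` and unit numerators∕denominators at EVERY
integral `X` with `|X + σX| < 1` (which norm-one `t = 1 + ϖX` forces: `X + σX = −ϖ·XσX`) — because `σa − X ≡ 0` would give, adding its σ-conjugate, `|1 − (X + σX)| < 1`.  Hence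
(§5) the WILD CAYLEY LITERAL `Y_i = (X_i + a)∕(σa + (ϖσa − 1)X_i)`: norm one, `R_Y = R_X`, `Y⁻¹ ∈ R_Y`, `|Y_i − Y_j| = |X_i − X_j|`, with NO hypothesis on `|2|`.
* §1 `moebius_sub_moebius`, `neg_mul_moebius_add_eq`, `invMoebius_moebius` (field identities);
* §2 `moebius_mem_span_pow`, **`span_pow_moebius_eq`**, `moebius_inv_mem_span_pow` (orders, any subring `O`);
* §3 **`map_moebiusTorus_mul_self`** (norm one), `moebiusTorus_eq_moebius_shift` (the `X`-form), `add_map_eq_neg_mul_of_map_mul_self` (`X + σX = −ϖXσX`);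
* §4 **`valued_sub_eq_one_and_of_trace_one`** (`|σa − X| = |a + X| = 1`), `valued_moebiusShift_den_eq_one`, `valued_moebiusShift_num_eq_one`, `valued_one_sub_mul_norm_eq_one`,
  `valued_moebius_sub_moebius`;
* §5 **`exists_wild_cayley_literal`** — the package the (M5-β) literal file consumes.

## References
* [SerreLocalFields1979] J.-P. Serre, *Local Fields* (1979), Ch. III §6 (orders in split algebras), Ch. V §2 Prop. 3 (trace surjective in unramified extensions), §3.
* [Weil1964] A. Weil, *Sur certains groupes d'opérateurs unitaires*, Acta Math. 111 (1964), §29 (Cayley ∕ Möbius parametrisation of unitary elements).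
* [Kottwitz1986] R. E. Kottwitz, *Base change for unit elements of Hecke algebras*, Compositio Math. 60 (1986), §3 (the level recursion, all residue characteristics).
* [Rogawski1990] J. D. Rogawski, *Automorphic Representations of Unitary Groups in Three Variables* (1990), §4.9 p. 54.
-/

set_option autoImplicit false

open Polynomial Finset

namespace Literature.NumberTheory.Automorphic

/-! ## §1 Möbius algebra over a field -/

section MoebiusAlgebra

variable {K : Type*} [Field K]

/-- **Differences under a Möbius transform**: `Y_i − Y_j = det·(z_i − z_j)∕(den_i·den_j)` (generalises ★ `cayley_sub_cayley`, `det = 2`). [cite: Weil1964, §29] -/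
theorem moebius_sub_moebius {p q r s zi zj : K} (hi : r * zi + s ≠ 0) (hj : r * zj + s ≠ 0) :
    (p * zi + q) / (r * zi + s) - (p * zj + q) / (r * zj + s) = (p * s - q * r) * (zi - zj) / ((r * zi + s) * (r * zj + s)) := by
  rw [div_sub_div _ _ hi hj]
  congr 1
  ring

/-- The denominator of the INVERSE Möbius transform at `Y = (pz + q)∕(rz + s)` is `det ∕ (rz + s)`. [cite: Weil1964, §29] -/
theorem neg_mul_moebius_add_eq {p q r s z : K} (h : r * z + s ≠ 0) :
    -r * ((p * z + q) / (r * z + s)) + p = (p * s - q * r) / (r * z + s) := by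
  rw [eq_div_iff h, add_mul, mul_div_assoc', div_mul_cancel₀ _ h]
  ring

/-- The numerator of the inverse Möbius transform: `s·Y − q = det·z ∕ (rz + s)`. [cite: Weil1964, §29] -/
theorem mul_moebius_sub_eq {p q r s z : K} (h : r * z + s ≠ 0) :
    s * ((p * z + q) / (r * z + s)) - q = (p * s - q * r) * z / (r * z + s) := by
  rw [eq_div_iff h, sub_mul, mul_div_assoc', div_mul_cancel₀ _ h]
  ring

/-- **The inverse Möbius transform recovers `z`**: `(sY − q)∕(−rY + p) = z` for `Y = (pz + q)∕(rz + s)`, unit... non-zero determinant. [cite: Weil1964, §29] -/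
theorem invMoebius_moebius {p q r s z : K} (h : r * z + s ≠ 0) (hdet : p * s - q * r ≠ 0) :
    (s * ((p * z + q) / (r * z + s)) - q) / (-r * ((p * z + q) / (r * z + s)) + p) = z := by
  rw [neg_mul_moebius_add_eq h, mul_moebius_sub_eq h]
  field_simp

end MoebiusAlgebra

/-! ## §2 The order `R_Z = span_O {Z^j}` is preserved by a unit-determinant integral Möbius transform with unit denominators -/

section Order

variable {K : Type*} [Field K] {n : ℕ} (O : Subring K)

/-- `Z ∈ R_Z`. [cite: SerreLocalFields1979, Ch. III §6] -/
theorem self_mem_span_pow {Z : Fin n → K} (hZ : ∀ i, Z i ∈ O) :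
    Z ∈ Submodule.span O (Set.range fun j : Fin n => fun i => Z i ^ (j : ℕ)) := by
  have h := eval_mem_span_pow O hZ (γ := Z) Polynomial.X
  simp only [Polynomial.map_X, Polynomial.eval_X] at h
  exact h

/-- An affine image `r·Z + s` (`r, s ∈ O`) lies in `R_Z`. [cite: SerreLocalFields1979, Ch. III §6] -/
theorem affine_mem_span_pow {Z : Fin n → K} (hZ : ∀ i, Z i ∈ O) {r s : K} (hr : r ∈ O) (hs : s ∈ O) :
    (fun i => r * Z i + s) ∈ Submodule.span O (Set.range fun j : Fin n => fun i => Z i ^ (j : ℕ)) := by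
  have h : (fun i => r * Z i + s) = (⟨r, hr⟩ : O) • Z + (⟨s, hs⟩ : O) • (1 : Fin n → K) := by
    funext i
    simp only [Pi.add_apply, Pi.smul_apply, Pi.one_apply, Subring.smul_def, smul_eq_mul, mul_one]
  rw [h]
  exact Submodule.add_mem _ (Submodule.smul_mem _ _ (self_mem_span_pow O hZ)) (Submodule.smul_mem _ _ (one_mem_span_pow O hZ))

/-- **A Möbius image with unit denominators lies in the order**: `(pZ + q)(rZ + s)⁻¹ ∈ R_Z` when `p q r s ∈ O` and every `rZ_i + s` is a unit of `O` (★ `inv_mem_span_pow`).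
[cite: SerreLocalFields1979, Ch. III §6] -/
theorem moebius_mem_span_pow {Z : Fin n → K} (hZ : ∀ i, Z i ∈ O) {p q r s : K} (hp : p ∈ O) (hq : q ∈ O) (hr : r ∈ O) (hs : s ∈ O)
    (hden : ∀ i, ∃ y ∈ O, y * (r * Z i + s) = 1) :
    (fun i => (p * Z i + q) / (r * Z i + s)) ∈ Submodule.span O (Set.range fun j : Fin n => fun i => Z i ^ (j : ℕ)) := by
  have hinv := inv_mem_span_pow O hZ (affine_mem_span_pow O hZ hr hs) hden
  have h : (fun i => (p * Z i + q) / (r * Z i + s)) = (fun i => p * Z i + q) * (fun i => r * Z i + s)⁻¹ := by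
    funext i
    simp only [Pi.mul_apply, Pi.inv_apply, div_eq_mul_inv]
  rw [h]
  exact mul_mem_span_pow O hZ (affine_mem_span_pow O hZ hp hq) hinv

/-- **`R_Z = R_Y` FOR A UNIT-DETERMINANT INTEGRAL MÖBIUS TRANSFORM `Y = (pZ + q)(rZ + s)⁻¹` WITH UNIT DENOMINATORS** — the `2`-free form of ★ `span_pow_cayleyParam_eq_span_pow_cayley`
(there `(p q; r s) = (1 1; −1 1)`, determinant `2`): `Y ∈ R_Z` by `moebius_mem_span_pow`; conversely `Z = (sY − q)(−rY + p)⁻¹` is the INVERSE Möbius image of `Y`, again integral,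
and its denominators `−rY_i + p = det∕(rZ_i + s)` are units. [cite: SerreLocalFields1979, Ch. III §6] [cite: Weil1964, §29] [cite: Kottwitz1986, §3] -/
theorem span_pow_moebius_eq {Z : Fin n → K} (hZ : ∀ i, Z i ∈ O) {p q r s : K} (hp : p ∈ O) (hq : q ∈ O) (hr : r ∈ O) (hs : s ∈ O)
    (hdet : ∃ y ∈ O, y * (p * s - q * r) = 1) (hden : ∀ i, ∃ y ∈ O, y * (r * Z i + s) = 1) :
    Submodule.span O (Set.range fun j : Fin n => fun i => Z i ^ (j : ℕ)) =
      Submodule.span O (Set.range fun j : Fin n => fun i => ((p * Z i + q) / (r * Z i + s)) ^ (j : ℕ)) := by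
  have hden' : ∀ i, r * Z i + s ≠ 0 ∧ (r * Z i + s)⁻¹ ∈ O := fun i => ne_zero_and_inv_mem_of_exists_mul_eq_one O (hden i)
  have hdet' : p * s - q * r ≠ 0 ∧ (p * s - q * r)⁻¹ ∈ O := ne_zero_and_inv_mem_of_exists_mul_eq_one O hdet
  -- the Möbius image is integral
  have hY : ∀ i, (p * Z i + q) / (r * Z i + s) ∈ O := fun i => by
    rw [div_eq_mul_inv]
    exact Subring.mul_mem _ (Subring.add_mem _ (Subring.mul_mem _ hp (hZ i)) hq) (hden' i).2
  apply le_antisymm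
  · -- `Z` is the inverse Möbius image of `Y`, with unit denominators `det ∕ (rZ_i + s)`
    refine span_pow_le_span_pow_of_mem O hY ?_
    have hdenY : ∀ i, ∃ y ∈ O, y * (-r * ((p * Z i + q) / (r * Z i + s)) + p) = 1 := fun i =>
      ⟨(p * s - q * r)⁻¹ * (r * Z i + s), Subring.mul_mem _ hdet'.2 (Subring.add_mem _ (Subring.mul_mem _ hr (hZ i)) hs), by
        rw [neg_mul_moebius_add_eq (hden' i).1, div_eq_mul_inv, mul_mul_mul_comm, inv_mul_cancel₀ hdet'.1, mul_inv_cancel₀ (hden' i).1, one_mul]⟩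
    have hmem := moebius_mem_span_pow O hY (p := s) (q := -q) (r := -r) (s := p) hs (Subring.neg_mem _ hq) (Subring.neg_mem _ hr) hp hdenY
    have hZeq : (fun i => (s * ((p * Z i + q) / (r * Z i + s)) + -q) / (-r * ((p * Z i + q) / (r * Z i + s)) + p)) = Z := by
      funext i
      rw [← sub_eq_add_neg, invMoebius_moebius (hden' i).1 hdet'.1]
    rw [hZeq] at hmem
    exact hmem
  · exact span_pow_le_span_pow_of_mem O hZ (moebius_mem_span_pow O hZ hp hq hr hs hden)

/-- **`Y⁻¹ ∈ R_Y`** for a Möbius image whose numerators are units as well (so every `Y_i` is a unit of `O`). [cite: SerreLocalFields1979, Ch. III §6] -/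
theorem moebius_inv_mem_span_pow {Z : Fin n → K} (hZ : ∀ i, Z i ∈ O) {p q r s : K} (hp : p ∈ O) (hq : q ∈ O) (hr : r ∈ O) (hs : s ∈ O)
    (hnum : ∀ i, ∃ y ∈ O, y * (p * Z i + q) = 1) (hden : ∀ i, ∃ y ∈ O, y * (r * Z i + s) = 1) :
    (fun i => (p * Z i + q) / (r * Z i + s))⁻¹ ∈ Submodule.span O (Set.range fun j : Fin n => fun i => ((p * Z i + q) / (r * Z i + s)) ^ (j : ℕ)) := by
  have hden' : ∀ i, r * Z i + s ≠ 0 ∧ (r * Z i + s)⁻¹ ∈ O := fun i => ne_zero_and_inv_mem_of_exists_mul_eq_one O (hden i)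
  have hnum' : ∀ i, p * Z i + q ≠ 0 ∧ (p * Z i + q)⁻¹ ∈ O := fun i => ne_zero_and_inv_mem_of_exists_mul_eq_one O (hnum i)
  have hY : ∀ i, (p * Z i + q) / (r * Z i + s) ∈ O := fun i => by
    rw [div_eq_mul_inv]
    exact Subring.mul_mem _ (Subring.add_mem _ (Subring.mul_mem _ hp (hZ i)) hq) (hden' i).2
  refine inv_mem_span_pow O hY (self_mem_span_pow O hY) fun i => ?_
  refine ⟨(p * Z i + q)⁻¹ * (r * Z i + s), Subring.mul_mem _ (hnum' i).2 (Subring.add_mem _ (Subring.mul_mem _ hr (hZ i)) hs), ?_⟩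
  rw [div_eq_mul_inv, mul_mul_mul_comm, inv_mul_cancel₀ (hnum' i).1, mul_inv_cancel₀ (hden' i).1, one_mul]

end Order

/-! ## §3 Norm one: the shape `(βt + α)∕(σα·t + σβ)` and its `X`-form -/

section NormOne

variable {K : Type*} [Field K] (σ : K →+* K)

/-- **THE MÖBIUS LITERAL IS NORM ONE, IDENTICALLY**: for an involution `σ`, a norm-one `t` (`σt·t = 1`) and ANY `α, β`, the element `Y = (βt + α)∕(σα·t + σβ)` — i.e.
`p(t)∕(t·σp(t⁻¹))` for `p = βT + α` — satisfies `σY·Y = 1` (numerator and denominator of `σY` are `den∕t` and `num∕t`).  The Cayley literal is `β = 1 + ϖ`, `α = ϖ − 1`.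
[cite: Weil1964, §29] [cite: Kottwitz1986, §3] -/
theorem map_moebiusTorus_mul_self (hσσ : ∀ x, σ (σ x) = x) {t α β : K} (ht : σ t * t = 1)
    (hnum : β * t + α ≠ 0) (hden : σ α * t + σ β ≠ 0) :
    σ ((β * t + α) / (σ α * t + σ β)) * ((β * t + α) / (σ α * t + σ β)) = 1 := by
  have ht0 : t ≠ 0 := fun h0 => by rw [h0, mul_zero] at ht; exact zero_ne_one ht
  have hσt : σ t = t⁻¹ := eq_inv_of_mul_eq_one_left ht
  have hσnum : σ (β * t + α) = (σ α * t + σ β) / t := by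
    rw [map_add, map_mul, hσt]
    field_simp
    ring
  have hσden : σ (σ α * t + σ β) = (β * t + α) / t := by
    rw [map_add, map_mul, hσσ, hσσ, hσt]
    field_simp
    ring
  rw [map_div₀, hσnum, hσden, div_div_div_cancel_right₀ ht0, div_mul_div_comm, mul_comm (σ α * t + σ β) (β * t + α), div_self (mul_ne_zero hnum hden)]

/-- **The `X`-form**: with `t = 1 + ϖX`, `σϖ = ϖ`, `ϖ ≠ 0` and `α = −β + ϖγ`, `(βt + α)∕(σα·t + σβ) = (βX + γ)∕(σα·X + σγ)` (both numerator and denominator carry a factor `ϖ`).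
[cite: SerreLocalFields1979, Ch. V §3] -/
theorem moebiusTorus_eq_moebius_shift {ϖ X t α β γ : K} (hϖ : ϖ ≠ 0) (hσϖ : σ ϖ = ϖ) (ht : t = 1 + ϖ * X) (hα : α = -β + ϖ * γ) :
    (β * t + α) / (σ α * t + σ β) = (β * X + γ) / (σ α * X + σ γ) := by
  have hnum : β * t + α = ϖ * (β * X + γ) := by rw [ht, hα]; ring
  have hden : σ α * t + σ β = ϖ * (σ α * X + σ γ) := by
    have h1 : σ α + σ β = ϖ * σ γ := by rw [← map_add, hα, show -β + ϖ * γ + β = ϖ * γ by ring, map_mul, hσϖ]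
    calc σ α * t + σ β = (σ α + σ β) + ϖ * (σ α * X) := by rw [ht]; ring
      _ = ϖ * (σ α * X + σ γ) := by rw [h1]; ring
  rw [hnum, hden, mul_div_mul_left _ _ hϖ]

/-- **Norm one near `1` forces a small trace**: if `t = 1 + ϖX` has `σt·t = 1` (`σϖ = ϖ ≠ 0`) then `X + σX = −ϖ·(X·σX)`. [cite: SerreLocalFields1979, Ch. V §3] -/
theorem add_map_eq_neg_mul_of_map_mul_self {ϖ X t : K} (hϖ : ϖ ≠ 0) (hσϖ : σ ϖ = ϖ) (ht : t = 1 + ϖ * X) (hN : σ t * t = 1) :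
    X + σ X = -(ϖ * (X * σ X)) := by
  rw [ht, map_add, map_one, map_mul, hσϖ] at hN
  have h : ϖ * (X + σ X + ϖ * (X * σ X)) = 0 := by linear_combination hN
  have h2 : X + σ X + ϖ * (X * σ X) = 0 := (mul_eq_zero.1 h).resolve_left hϖ
  linear_combination h2

end NormOne

/-! ## §4 Valued fields: the trace-one element makes the Möbius data units — no hypothesis on `|2|` -/

section ValuedField

variable {K : Type*} [Field K] {Γ₀ : Type*} [LinearOrderedCommGroupWithZero Γ₀] [Valued K Γ₀] (σ : K →+* K)

/-- **`|σa − X| = 1` and `|a + X| = 1`** for an isometric involution `σ`, a TRACE-ONE integral element `a` (`a + σa = 1`) and an integral `X` with `|X + σX| < 1`: otherwise, adding the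
`σ`-conjugate inequality, `|1 − (X + σX)| < 1` resp. `|1 + (X + σX)| < 1`, impossible.  (Residue-field reading: `Tr X̄ = 0 ≠ 1 = Tr ā`.) [cite: SerreLocalFields1979, Ch. V §2 Prop. 3] -/
theorem valued_sub_eq_one_and_of_trace_one (hσσ : ∀ x, σ (σ x) = x) (hσv : ∀ x, Valued.v (σ x) = Valued.v x)
    {a X : K} (ha : a + σ a = 1) (haO : Valued.v a ≤ 1) (hXO : Valued.v X ≤ 1) (hXσ : Valued.v (X + σ X) < 1) :
    Valued.v (σ a - X) = 1 ∧ Valued.v (a + X) = 1 := by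
  have hσaO : Valued.v (σ a) ≤ 1 := by rwa [hσv]
  have hσXO : Valued.v (σ X) ≤ 1 := by rwa [hσv]
  have key : ∀ {u : K}, Valued.v u ≤ 1 → (u + σ u = 1 - (X + σ X) ∨ u + σ u = 1 + (X + σ X)) → Valued.v u = 1 := by
    intro u hu hsum
    by_contra hne
    have hlt : Valued.v u < 1 := lt_of_le_of_ne hu hne
    have hlt' : Valued.v (σ u) < 1 := by rwa [hσv]
    have hs : Valued.v (u + σ u) < 1 := (Valuation.map_add _ _ _).trans_lt (max_lt hlt hlt')
    have h1 : Valued.v (u + σ u) = 1 := by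
      rcases hsum with h | h
      · rw [h, Valuation.map_sub_eq_of_lt_left _ (by rwa [Valuation.map_one])]
        exact Valuation.map_one _
      · rw [h, Valuation.map_add_eq_of_lt_left _ (by rwa [Valuation.map_one])]
        exact Valuation.map_one _
    exact absurd h1 hs.ne
  refine ⟨key ((Valuation.map_sub _ _ _).trans (max_le hσaO hXO)) (Or.inl ?_), key ((Valuation.map_add _ _ _).trans (max_le haO hXO)) (Or.inr ?_)⟩
  · rw [map_sub, hσσ]; linear_combination ha
  · rw [map_add]; linear_combination ha

/-- **The denominator of the wild Cayley literal is a unit**: `|σa + (ϖσa − 1)X| = 1` (`= (σa − X) + ϖσaX` with `|ϖ| < 1`). [cite: SerreLocalFields1979, Ch. V §3] -/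
theorem valued_moebiusShift_den_eq_one (hσσ : ∀ x, σ (σ x) = x) (hσv : ∀ x, Valued.v (σ x) = Valued.v x) {ϖ : K} (hϖ : Valued.v ϖ < 1)
    {a X : K} (ha : a + σ a = 1) (haO : Valued.v a ≤ 1) (hXO : Valued.v X ≤ 1) (hXσ : Valued.v (X + σ X) < 1) :
    Valued.v (σ a + (ϖ * σ a - 1) * X) = 1 := by
  have h1 := (valued_sub_eq_one_and_of_trace_one σ hσσ hσv ha haO hXO hXσ).1
  have hsmall : Valued.v (ϖ * (σ a * X)) < 1 := by
    rw [map_mul, map_mul, hσv]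
    calc Valued.v ϖ * (Valued.v a * Valued.v X) ≤ Valued.v ϖ * (1 * 1) := by gcongr
      _ < 1 := by rwa [mul_one, mul_one]
  rw [show σ a + (ϖ * σ a - 1) * X = (σ a - X) + ϖ * (σ a * X) by ring, Valuation.map_add_eq_of_lt_left _ (by rwa [h1]), h1]

/-- **The numerator of the wild Cayley literal is a unit**: `|X + a| = 1`. [cite: SerreLocalFields1979, Ch. V §3] -/
theorem valued_moebiusShift_num_eq_one (hσσ : ∀ x, σ (σ x) = x) (hσv : ∀ x, Valued.v (σ x) = Valued.v x)
    {a X : K} (ha : a + σ a = 1) (haO : Valued.v a ≤ 1) (hXO : Valued.v X ≤ 1) (hXσ : Valued.v (X + σ X) < 1) :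
    Valued.v (1 * X + a) = 1 := by
  rw [one_mul, add_comm]
  exact (valued_sub_eq_one_and_of_trace_one σ hσσ hσv ha haO hXO hXσ).2

/-- **The determinant of the wild Cayley literal is a unit**: `|1 − ϖ·aσa| = 1` — in the normalisation `p = 1, q = a, r = ϖσa − 1, s = σa`:
`ps − qr = σa − a(ϖσa − 1) = (a + σa) − ϖaσa = 1 − ϖaσa`. [cite: SerreLocalFields1979, Ch. V §3] -/
theorem valued_one_sub_mul_norm_eq_one (hσv : ∀ x, Valued.v (σ x) = Valued.v x) {ϖ : K} (hϖ : Valued.v ϖ < 1) {a : K} (ha : a + σ a = 1) (haO : Valued.v a ≤ 1) :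
    Valued.v (1 * σ a - a * (ϖ * σ a - 1)) = 1 := by
  have hsmall : Valued.v (ϖ * (a * σ a)) < 1 := by
    rw [map_mul, map_mul, hσv]
    calc Valued.v ϖ * (Valued.v a * Valued.v a) ≤ Valued.v ϖ * (1 * 1) := by gcongr
      _ < 1 := by rwa [mul_one, mul_one]
  rw [show 1 * σ a - a * (ϖ * σ a - 1) = 1 - ϖ * (a * σ a) by linear_combination ha, Valuation.map_sub_eq_of_lt_left _ (by rwa [Valuation.map_one])]
  exact Valuation.map_one _

/-- **Root distances under an integral Möbius transform**: `|Y_i − Y_j| = |det|·|z_i − z_j| ∕ (|den_i|·|den_j|)`; with unit determinant and unit denominators the distances are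
KEPT (the Cayley case `det = 2` lowers them by `|2|` — ★ `valuation_cayley_sub_cayley` absorbed that into `c`). [cite: Weil1964, §29] [cite: Rogawski1990, §4.9 p. 54] -/
theorem valued_moebius_sub_moebius {p q r s zi zj : K} (hi : Valued.v (r * zi + s) = 1) (hj : Valued.v (r * zj + s) = 1) (hdet : Valued.v (p * s - q * r) = 1) :
    Valued.v ((p * zi + q) / (r * zi + s) - (p * zj + q) / (r * zj + s)) = Valued.v (zi - zj) := by
  have hi0 : r * zi + s ≠ 0 := fun h0 => by rw [h0, map_zero] at hi; exact zero_ne_one hi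
  have hj0 : r * zj + s ≠ 0 := fun h0 => by rw [h0, map_zero] at hj; exact zero_ne_one hj
  rw [moebius_sub_moebius hi0 hj0, map_div₀, map_mul, map_mul, hdet, hi, hj, one_mul, mul_one, div_one]

end ValuedField

/-! ## §5 The WILD CAYLEY LITERAL package (what the (M5-β) literal file consumes) -/

section Package

variable {K : Type*} [Field K] {Γ₀ : Type*} [LinearOrderedCommGroupWithZero Γ₀] [Valued K Γ₀] {n : ℕ} (O : Subring K) (σ : K →+* K)

/-- **THE WILD CAYLEY LITERAL — every residue characteristic.**  `O` a subring containing every element of valuation `≤ 1` and contained in them (the valuation ring), `σ` an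
isometric involution, `ϖ ∈ O` `σ`-fixed with `|ϖ| < 1` (a `σ`-fixed uniformiser in the applications), `a` with `a + σa = 1` (★ `UnramifiedLocalConjDatum.trace`), and norm-one
eigenvalues `t_i = 1 + ϖX_i` with `X_i ∈ O`.  Then the Möbius literal `Y_i := (X_i + a)∕(σa + (ϖσa − 1)X_i)` is NORM ONE (`σY_i·Y_i = 1`), generates the SAME order as `X`
(`R_X = R_Y`), has `Y⁻¹ ∈ R_Y`, and KEEPS the root distances `|Y_i − Y_j| = |X_i − X_j|` — the `h2`-free replacement of ★ `span_pow_shift_eq_span_pow_cayleyParam` ∘ ★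
`span_pow_cayleyParam_eq_span_pow_cayley` ∘ ★ `cayley_inv_mem_span_pow` ∘ ★ `map_cayley_mul_cayley` ∘ ★ `valuation_cayley_sub_cayley` (there `|X_i − X_j| = |t_i − t_j| ∕ |ϖ|` is
the shift by one).  [cite: Kottwitz1986, §3] [cite: Weil1964, §29] [cite: SerreLocalFields1979, Ch. III §6; Ch. V §2 Prop. 3, §3] [cite: Rogawski1990, §4.9 p. 54] -/
theorem exists_wild_cayley_literal (hO : ∀ z : K, Valued.v z ≤ 1 → z ∈ O) (hO' : ∀ z ∈ O, Valued.v z ≤ 1)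
    (hσσ : ∀ x, σ (σ x) = x) (hσv : ∀ x, Valued.v (σ x) = Valued.v x)
    {ϖ : K} (hϖ1 : Valued.v ϖ < 1) (hϖ0 : ϖ ≠ 0) (hσϖ : σ ϖ = ϖ) {a : K} (ha : a + σ a = 1) (haO : Valued.v a ≤ 1)
    {X : Fin n → K} (hX : ∀ i, X i ∈ O) (hN : ∀ i, σ (1 + ϖ * X i) * (1 + ϖ * X i) = 1) :
    (∀ i, σ ((X i + a) / (σ a + (ϖ * σ a - 1) * X i)) * ((X i + a) / (σ a + (ϖ * σ a - 1) * X i)) = 1) ∧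
    Submodule.span O (Set.range fun j : Fin n => fun i => X i ^ (j : ℕ)) =
      Submodule.span O (Set.range fun j : Fin n => fun i => ((X i + a) / (σ a + (ϖ * σ a - 1) * X i)) ^ (j : ℕ)) ∧
    (fun i => (X i + a) / (σ a + (ϖ * σ a - 1) * X i))⁻¹ ∈
      Submodule.span O (Set.range fun j : Fin n => fun i => ((X i + a) / (σ a + (ϖ * σ a - 1) * X i)) ^ (j : ℕ)) ∧
    ∀ i j, Valued.v ((X i + a) / (σ a + (ϖ * σ a - 1) * X i) - (X j + a) / (σ a + (ϖ * σ a - 1) * X j)) = Valued.v (X i - X j) := by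
  -- the small traces `X_i + σX_i = −ϖ X_i σX_i`
  have hXO : ∀ i, Valued.v (X i) ≤ 1 := fun i => hO' _ (hX i)
  have hXσ : ∀ i, Valued.v (X i + σ (X i)) < 1 := fun i => by
    rw [add_map_eq_neg_mul_of_map_mul_self σ hϖ0 hσϖ rfl (hN i), Valuation.map_neg, map_mul, map_mul, hσv]
    calc Valued.v ϖ * (Valued.v (X i) * Valued.v (X i)) ≤ Valued.v ϖ * (1 * 1) := by gcongr <;> exact hXO i
      _ < 1 := by rwa [mul_one, mul_one]
  -- units: denominators, numerators, determinant (normalisation `p = 1, q = a, r = ϖσa − 1, s = σa`)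
  have hden : ∀ i, Valued.v ((ϖ * σ a - 1) * X i + σ a) = 1 := fun i => by
    rw [add_comm]; exact valued_moebiusShift_den_eq_one σ hσσ hσv hϖ1 ha haO (hXO i) (hXσ i)
  have hnum : ∀ i, Valued.v (1 * X i + a) = 1 := fun i => valued_moebiusShift_num_eq_one σ hσσ hσv ha haO (hXO i) (hXσ i)
  have hdet : Valued.v (1 * σ a - a * (ϖ * σ a - 1)) = 1 := valued_one_sub_mul_norm_eq_one σ hσv hϖ1 ha haO
  have unitO : ∀ {z : K}, Valued.v z = 1 → ∃ y ∈ O, y * z = 1 := fun {z} hz => by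
    have hz0 : z ≠ 0 := fun h0 => by rw [h0, map_zero] at hz; exact zero_ne_one hz
    exact ⟨z⁻¹, hO _ (by rw [map_inv₀, hz, inv_one]), inv_mul_cancel₀ hz0⟩
  have haO' : a ∈ O := hO _ haO
  have hσaO : σ a ∈ O := hO _ (by rw [hσv]; exact haO)
  have hϖO : ϖ ∈ O := hO _ hϖ1.le
  have hrO : ϖ * σ a - 1 ∈ O := Subring.sub_mem _ (Subring.mul_mem _ hϖO hσaO) (Subring.one_mem _)
  -- rewrite the literal in the `(pX + q)∕(rX + s)` normal form
  have hform : ∀ i, (X i + a) / (σ a + (ϖ * σ a - 1) * X i) = (1 * X i + a) / ((ϖ * σ a - 1) * X i + σ a) := fun i => by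
    rw [one_mul, add_comm (σ a)]
  have e2 : (fun j : Fin n => fun i => ((X i + a) / (σ a + (ϖ * σ a - 1) * X i)) ^ (j : ℕ)) =
      fun j : Fin n => fun i => ((1 * X i + a) / ((ϖ * σ a - 1) * X i + σ a)) ^ (j : ℕ) := by
    funext j i; rw [hform i]
  refine ⟨fun i => ?_, ?_, ?_, fun i j => ?_⟩
  · -- norm one: the `X`-form of `(βt + α)∕(σα t + σβ)` with `β = 1`, `γ = a`, `α = −1 + ϖa` (so `σα = ϖσa − 1`)
    have hnum0 : 1 * (1 + ϖ * X i) + (-1 + ϖ * a) ≠ 0 := by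
      rw [show 1 * (1 + ϖ * X i) + (-1 + ϖ * a) = ϖ * (1 * X i + a) by ring]
      exact mul_ne_zero hϖ0 fun h0 => by have := hnum i; rw [h0, map_zero] at this; exact zero_ne_one this
    have hden0 : σ (-1 + ϖ * a) * (1 + ϖ * X i) + σ 1 ≠ 0 := by
      have e : σ (-1 + ϖ * a) = ϖ * σ a - 1 := by rw [map_add, map_neg, map_one, map_mul, hσϖ]; ring
      rw [e, map_one, show (ϖ * σ a - 1) * (1 + ϖ * X i) + 1 = ϖ * ((ϖ * σ a - 1) * X i + σ a) by ring]
      exact mul_ne_zero hϖ0 fun h0 => by have := hden i; rw [h0, map_zero] at this; exact zero_ne_one this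
    have h := map_moebiusTorus_mul_self σ hσσ (hN i) hnum0 hden0
    have e := moebiusTorus_eq_moebius_shift σ (X := X i) (t := 1 + ϖ * X i) (α := -1 + ϖ * a) (β := 1) (γ := a) hϖ0 hσϖ rfl (by ring)
    have eσ : σ (-1 + ϖ * a) = ϖ * σ a - 1 := by rw [map_add, map_neg, map_one, map_mul, hσϖ]; ring
    rw [e, eσ] at h
    rwa [hform i]
  · rw [e2]
    exact span_pow_moebius_eq O hX (Subring.one_mem _) haO' hrO hσaO (unitO hdet) (fun i => unitO (hden i))
  · have e : (fun i => (X i + a) / (σ a + (ϖ * σ a - 1) * X i)) = fun i => (1 * X i + a) / ((ϖ * σ a - 1) * X i + σ a) := funext hform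
    rw [e2, e]
    exact moebius_inv_mem_span_pow O hX (Subring.one_mem _) haO' hrO hσaO (fun i => unitO (hnum i)) (fun i => unitO (hden i))
  · rw [hform i, hform j]
    exact valued_moebius_sub_moebius (hden i) (hden j) hdet

end Package

end Literature.NumberTheory.Automorphic
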